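import Summits.HodgeConjecture.CorCM.Census.CentralSquaresPairFaceDefects
import Summits.HodgeConjecture.CorCM.Census.CentralSquaresFourTypeLaw
import Summits.HodgeConjecture.CorCM.Census.TwistScrewShift

/-!
# The square-central class, XIX: the DESIGNATED PAIR FACE at `m = 2` gives `Y'_a + Y'_{σa} ∈ L` and `Y_s + Y_{σs} ∈ L`

COR-CM (cell `pub-hodgecm2`), count-neutral kernel combinatorics by the binder seat b09 (gen 46; lane SQUARE-CENTRAL CLASS, part XIX), on parts XVIII (corner
defects, `Q`-stability), VI (`rel_transversal_mem`, `thetaG_frame`), VII (`companion_*`), VIII (`ne_rep`) and `mapDomain_rt_thetaG` (twist generation), BY NAME.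
Theorems only: no definition, no `decide`, no certificate, no named fact, no `sorry`.  HONEST FRAMING: `HC_CM` is NOT proved, here or anywhere in the tree;
nothing here is a period or a headline.

THE FRAME `(T₀; T₁, Q)` at `m = 2` (notation of part XVIII; `Y'_a = (f_a − e₀) − (g_a − e₁)` for `a ∈ T₀ ∩ T₁`, `R(T) = Σ_T f − Σ_{𝓗∖T} g − (m−1)(e₀ − e₁)`).
At `m ≥ 3` parts VI/VII produce `Y'_a + Y'_{σa}` and `Y_s + Y_{σs}` from the STRICT faces of the `Q`-stable level-`(m+2)` type.  At `m = 2` that type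
`Φ = {T | a, σa}` (`D(Φ) = T ∪ {a, σa}`, `T = {t, t'} ⊆ 𝓗` a `σ`-transversal, `a ∈ T₀ ∩ T₁`) sits at level `4 = n/2` and carries NO strict face; ONE designated
face `gface Φ t t' ∈ L` (places `T`; supplied in part XX by part XIIIʼs chosen covers) still does the job, modulo one relation of a second swap:

* §1 **`Y'_add_Y'_mem_of_pair_face`** (`m = 2`): `gface Φ t t' ∈ L` and `Rᶜ({a, σa}) ∈ L` ⟹ **`Y'_a + Y'_{σa} ∈ L`**.  Proof: the face has type sum `0`, so
  by part XVIII the `T₀`-defect of `Φ` is `w ∈ {0, −Y_t, −Y_{t'}, −Y_t − Y_{t'}}` modulo `L`; the swap fixes `Φ` and fixes `w` modulo `L`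
  (`Y_p·Q⁻¹ = Y_{σp} ≡ Y_p`), so the `T₁`-defect of `Φ` is congruent to the same `w`; the difference `θ_{T₀}(Φ) − θ_{T₁}(Φ)` is `R(T) + Y'_a + Y'_{σa}` (part VIʼs
  computation) and `R(T) ∈ L`.  No direction case needs a certificate: the eight cover patterns differ by elements of `L`.
* §2 **`Y_add_Y_mem_of_pair_face`**: §1 in the companion frame `(T₀; T̄₁, c·Q)` — a designated face at `{T' | s, σs}` (`T' ⊆ T₀ ∩ T₁` a `σ`-transversal,
  `s ∈ 𝓗`) and `R({s, σs}) ∈ L` give **`Y_s + Y_{σs} ∈ L`**.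
Part XX adds the second swap `zQ` (whose transversals are the `σ`-pairs, so `R({s,σs})`, `Rᶜ({a,σa}) ∈ L`, and whose differences make all `Y_s`, all `Y'_a`
congruent) and closes the residual lattice of the `m = 2` rows by part IIʼs `residual_closure_four`.

## References
* [Pohlmann1968] H. Pohlmann, Algebraic cycles on abelian varieties of complex multiplication type, Ann. of Math. 88 (1968), Thm 1.
* [Milne1999] J. S. Milne, Lefschetz motives and the Tate conjecture, Compositio Math. 117 (1999), Prop. 2.1, p. 54.
-/


namespace Summit.HodgeConjecture.CorCM.Census.CentralSquares

open Finset
open scoped symmDiff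
open Summit.HodgeConjecture.CorCM.Prior.AllgGroup.RfwfAllgGroup
open Summit.HodgeConjecture.CorCM.Census.BlockParity
open Summit.HodgeConjecture.CorCM.Census.Coinvariant
open Summit.HodgeConjecture.CorCM.Census.TwistGeneration
open Summit.HodgeConjecture.CorCM.Census.BaseBlock
open Summit.HodgeConjecture.CorCM.Census.CoverClosure

noncomputable section

variable {G : Type*} [Group G] [Fintype G] [DecidableEq G] (c : G)

section Frame

variable (hc2 : c * c = 1) (hcen : ∀ x : G, x * c = c * x) (T₀ T₁ : CMF G c)
variable (hbase : ∀ Q : G, rt c Q T₀ = T₀ ∨ rt c Q T₀ = rt c c T₀ ∨ rt c Q T₀ = T₁ ∨ rt c Q T₀ = rt c c T₁)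
variable (m : ℕ) (hn : T₀.1.card = 4 * m) (hH : (T₀.1 \ T₁.1).card = 2 * m)
variable (Q : G) (hQ : rt c Q T₀ = T₁) (hQQ : Q * Q = 1)
variable (hσH : ∀ t ∈ T₀.1, ∀ t' ∈ T₀.1, (t' = t * Q ∨ t' = c * (t * Q)) → (t ∈ T₀.1 \ T₁.1 ↔ t' ∈ T₀.1 \ T₁.1))
variable (L : Submodule ℤ (CMF G c →₀ ℤ)) (hLrt : ∀ (Q' : G) (y : CMF G c →₀ ℤ), y ∈ L → Finsupp.mapDomain (rt c Q') y ∈ L)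
variable (hP : ∀ Ψ : CMF G c, pair c Ψ ∈ L)
variable (hcover : ∀ Ψ : CMF G c, 2 ≤ bpot c T₀ Ψ → ∃ Q₂ s s' : G, bpot c T₀ Ψ = ddist (rt c Q₂ T₀) Ψ ∧
    s ∈ (rt c Q₂ T₀).1 \ Ψ.1 ∧ s' ∈ (rt c Q₂ T₀).1 \ Ψ.1 ∧ s ≠ s' ∧
    gface c hc2 Ψ s s' ∈ L ∧
    ((∃ Q₁ t t' : G, bpot c T₀ Ψ = ddist (rt c Q₁ T₀) Ψ ∧ t ∈ (rt c Q₁ T₀).1 \ Ψ.1 ∧ t' ∈ (rt c Q₁ T₀).1 \ Ψ.1 ∧ t ≠ t' ∧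
        (∀ Q' : G, ddist (rt c Q' T₀) (oflipCM c hc2 t Ψ) = bpot c T₀ (oflipCM c hc2 t Ψ) → rt c Q' T₀ = rt c Q₁ T₀) ∧
        (∀ Q' : G, ddist (rt c Q' T₀) (oflipCM c hc2 t' Ψ) = bpot c T₀ (oflipCM c hc2 t' Ψ) → rt c Q' T₀ = rt c Q₁ T₀) ∧
        (∀ Q' : G, ddist (rt c Q' T₀) (oflipCM c hc2 t (oflipCM c hc2 t' Ψ)) = bpot c T₀ (oflipCM c hc2 t (oflipCM c hc2 t' Ψ)) →
          rt c Q' T₀ = rt c Q₁ T₀)) →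
      (∀ Q' : G, ddist (rt c Q' T₀) (oflipCM c hc2 s Ψ) = bpot c T₀ (oflipCM c hc2 s Ψ) → rt c Q' T₀ = rt c Q₂ T₀) ∧
      (∀ Q' : G, ddist (rt c Q' T₀) (oflipCM c hc2 s' Ψ) = bpot c T₀ (oflipCM c hc2 s' Ψ) → rt c Q' T₀ = rt c Q₂ T₀) ∧
      (∀ Q' : G, ddist (rt c Q' T₀) (oflipCM c hc2 s (oflipCM c hc2 s' Ψ)) = bpot c T₀ (oflipCM c hc2 s (oflipCM c hc2 s' Ψ)) →
        rt c Q' T₀ = rt c Q₂ T₀)))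


/-! ## §1 The designated pair face gives `Y'_a + Y'_{σa}` -/

include hcen hbase hn hH hQ hQQ hσH hLrt hP hcover in
/-- **THE DESIGNATED PAIR FACE RELATION** (`m = 2`).  Let `T = {t, t'} ⊆ 𝓗` be a transversal of the place involution, `a ∈ T₀ ∩ T₁` with swap image `a'`,
and `Φ` the (`Q`-stable, level-4) type with `D(Φ) = T ∪ {a, a'}`.  If the face of `Φ` with places `t, t'` lies in `L` and `Rᶜ({a, a'}) ∈ L`, then
**`Y'_a + Y'_{a'} = ((f_a − e₀) − (g_a − e₁)) + ((f_{a'} − e₀) − (g_{a'} − e₁)) ∈ L`**. [folklore] -/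
theorem Y'_add_Y'_mem_of_pair_face (hm : m = 2) (T : Finset G) (hTH : T ⊆ T₀.1 \ T₁.1) (hTm : T.card = m)
    (hT : ∀ t ∈ T₀.1 \ T₁.1, ∀ t' ∈ T₀.1, (t' = t * Q ∨ t' = c * (t * Q)) → (t ∈ T ↔ t' ∉ T))
    {t t' : G} (hTe : T = {t, t'}) (htt' : t ≠ t')
    {a a' : G} (ha : a ∈ T₀.1 ∩ T₁.1) (ha' : a' ∈ T₀.1) (haa' : a' = a * Q ∨ a' = c * (a * Q))
    (Φ : CMF G c) (hΦ : T₀.1 \ Φ.1 = T ∪ {a, a'}) (hF : gface c hc2 Φ t t' ∈ L)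
    (hRc : ∑ s ∈ ({a, a'} : Finset G), Finsupp.single (oflipCM c hc2 s T₀) (1 : ℤ) +
        ∑ u ∈ (T₀.1 ∩ T₁.1) \ {a, a'}, Finsupp.single (oflipCM c hc2 u T₁) (1 : ℤ) -
        ((m : ℤ) - 1) • (Finsupp.single T₀ (1 : ℤ) + Finsupp.single T₁ 1) ∈ L) :
    ((Finsupp.single (oflipCM c hc2 a T₀) (1 : ℤ) - Finsupp.single T₀ 1) - (Finsupp.single (oflipCM c hc2 a T₁) (1 : ℤ) - Finsupp.single T₁ 1)) +
      ((Finsupp.single (oflipCM c hc2 a' T₀) (1 : ℤ) - Finsupp.single T₀ 1) - (Finsupp.single (oflipCM c hc2 a' T₁) (1 : ℤ) - Finsupp.single T₁ 1))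
      ∈ L := by
  have hm2 : 2 ≤ m := by omega
  have ha0 : a ∈ T₀.1 := (mem_inter.mp ha).1
  have ha1 : a ∈ T₁.1 := (mem_inter.mp ha).2
  have ha'1 : a' ∈ T₁.1 := by
    by_contra h
    exact (mem_sdiff.mp ((hσH a ha0 a' ha' haa').mpr (mem_sdiff.mpr ⟨ha', h⟩))).2 ha1
  have ha'i : a' ∈ T₀.1 ∩ T₁.1 := mem_inter.mpr ⟨ha', ha'1⟩
  have hne : a ≠ a' := ne_rep c hc2 T₀ T₁ m hH Q hQ hcen (by omega) ⟨a, ha⟩ haa'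
  have htT : t ∈ T := by rw [hTe]; exact mem_insert_self _ _
  have ht'T : t' ∈ T := by rw [hTe]; exact mem_insert_of_mem (mem_singleton_self _)
  have ht : t ∈ T₀.1 \ T₁.1 := hTH htT
  have ht' : t' ∈ T₀.1 \ T₁.1 := hTH ht'T
  have ht0 : t ∈ T₀.1 := (mem_sdiff.mp ht).1
  have ht'0 : t' ∈ T₀.1 := (mem_sdiff.mp ht').1
  have haH : a ∉ T₀.1 \ T₁.1 := fun h => (mem_sdiff.mp h).2 ha1
  have ha'H : a' ∉ T₀.1 \ T₁.1 := fun h => (mem_sdiff.mp h).2 ha'1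
  have htA : ∀ x ∈ T₀.1 \ T₁.1, x ∉ ({a, a'} : Finset G) := by
    intro x hx h; rw [mem_insert, mem_singleton] at h
    rcases h with rfl | rfl
    · exact haH hx
    · exact ha'H hx
  have hTA : Disjoint T ({a, a'} : Finset G) := by
    rw [disjoint_iff_ne]; rintro x hx y hy rfl; exact htA x (hTH hx) hy
  -- the deviation sets of the three corners
  have htΦ : t ∈ T₀.1 \ Φ.1 := by rw [hΦ]; exact mem_union_left _ htT
  have ht'Φ : t' ∈ T₀.1 \ Φ.1 := by rw [hΦ]; exact mem_union_left _ ht'T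
  have hX₂ : T₀.1 \ (oflipCM c hc2 t' Φ).1 = {t, a, a'} := by
    rw [dev_oflip c hc2 (mem_sdiff.mp ht'Φ).1 (mem_sdiff.mp ht'Φ).2, hΦ, hTe]
    ext x; simp only [mem_erase, mem_union, mem_insert, mem_singleton]
    constructor
    · rintro ⟨hx, (rfl | rfl) | h⟩
      · exact Or.inl rfl
      · exact absurd rfl hx
      · exact Or.inr h
    · rintro (rfl | h)
      · exact ⟨htt', Or.inl (Or.inl rfl)⟩
      · refine ⟨?_, Or.inr h⟩; rintro rfl; exact htA _ ht' (by rw [mem_insert, mem_singleton]; exact h)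
  have hX₁ : T₀.1 \ (oflipCM c hc2 t Φ).1 = {t', a, a'} := by
    rw [dev_oflip c hc2 (mem_sdiff.mp htΦ).1 (mem_sdiff.mp htΦ).2, hΦ, hTe]
    ext x; simp only [mem_erase, mem_union, mem_insert, mem_singleton]
    constructor
    · rintro ⟨hx, (rfl | rfl) | h⟩
      · exact absurd rfl hx
      · exact Or.inl rfl
      · exact Or.inr h
    · rintro (rfl | h)
      · exact ⟨htt'.symm, Or.inl (Or.inr rfl)⟩
      · refine ⟨?_, Or.inr h⟩; rintro rfl; exact htA _ ht (by rw [mem_insert, mem_singleton]; exact h)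
  have htX₂ : t ∈ T₀.1 \ (oflipCM c hc2 t' Φ).1 := by rw [hX₂]; exact mem_insert_self _ _
  have hX₁₂ : T₀.1 \ (oflipCM c hc2 t (oflipCM c hc2 t' Φ)).1 = {a, a'} := by
    rw [dev_oflip c hc2 (mem_sdiff.mp htX₂).1 (mem_sdiff.mp htX₂).2, hX₂, erase_insert]
    exact htA _ ht
  -- the defects of the corners
  have hd₁₂ := defect_pair_corner_mem c hc2 hcen T₀ T₁ hbase m hn hH L hP hcover hm ha ha'i hne _ hX₁₂ hRc
  have hd₁ := defect_tie_corner_cases c hc2 hcen T₀ T₁ hbase m hn hH Q hQ L hP hcover hm ht' ha ha'i hne _ hX₁ hRc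
  have hd₂ := defect_tie_corner_cases c hc2 hcen T₀ T₁ hbase m hn hH Q hQ L hP hcover hm ht ha ha'i hne _ hX₂ hRc
  -- the face has type sum zero: the defect of `Φ` is the alternating sum of the corner defects
  have hts : typeSum G c (gface c hc2 Φ t t') = 0 := typeSum_gface c hc2 Φ (notMem_orb_of_mem c ht0 ht'0 htt'.symm)
  have hg : gface c hc2 Φ t t' = Finsupp.single Φ 1 + Finsupp.single (oflipCM c hc2 t (oflipCM c hc2 t' Φ)) 1 -
      Finsupp.single (oflipCM c hc2 t Φ) 1 - Finsupp.single (oflipCM c hc2 t' Φ) 1 := rfl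
  have hsum : typeSum G c (Finsupp.single Φ 1) =
      - typeSum G c (Finsupp.single (oflipCM c hc2 t (oflipCM c hc2 t' Φ)) 1) +
        typeSum G c (Finsupp.single (oflipCM c hc2 t Φ) 1) + typeSum G c (Finsupp.single (oflipCM c hc2 t' Φ) 1) := by
    rw [hg, map_sub, map_sub, map_add] at hts
    linear_combination hts
  have hθ : thetaG c hc2 T₀ (typeSum G c (Finsupp.single Φ 1)) =
      - thetaG c hc2 T₀ (typeSum G c (Finsupp.single (oflipCM c hc2 t (oflipCM c hc2 t' Φ)) 1)) +
        thetaG c hc2 T₀ (typeSum G c (Finsupp.single (oflipCM c hc2 t Φ) 1)) +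
        thetaG c hc2 T₀ (typeSum G c (Finsupp.single (oflipCM c hc2 t' Φ) 1)) := by
    rw [hsum, map_add, map_add, map_neg]
  have hneg : ∀ v : CMF G c →₀ ℤ, Finsupp.mapDomain (rt c Q) (-v) = -Finsupp.mapDomain (rt c Q) v := fun v =>
    map_neg (Finsupp.mapDomain.addMonoidHom (rt c Q)) v
  have hρ : Finsupp.single Φ 1 - thetaG c hc2 T₀ (typeSum G c (Finsupp.single Φ 1)) =
      gface c hc2 Φ t t' -
        (Finsupp.single (oflipCM c hc2 t (oflipCM c hc2 t' Φ)) 1 -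
          thetaG c hc2 T₀ (typeSum G c (Finsupp.single (oflipCM c hc2 t (oflipCM c hc2 t' Φ)) 1))) +
        (Finsupp.single (oflipCM c hc2 t Φ) 1 - thetaG c hc2 T₀ (typeSum G c (Finsupp.single (oflipCM c hc2 t Φ) 1))) +
        (Finsupp.single (oflipCM c hc2 t' Φ) 1 - thetaG c hc2 T₀ (typeSum G c (Finsupp.single (oflipCM c hc2 t' Φ) 1))) := by
    rw [hθ, hg]; abel
  -- KEY: a defect `w` of `Φ` that is `Q`-invariant modulo `L` gives `θ_{T₀}(Φ) − θ_{T₁}(Φ) ∈ L`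
  have hΦQ : rt c Q Φ = Φ := rt_pair_type_eq_self c hc2 T₀ T₁ Q hQ hQQ hσH T hTH hT ha ha' haa' Φ hΦ
  have key : ∀ w : CMF G c →₀ ℤ, Finsupp.single Φ 1 - thetaG c hc2 T₀ (typeSum G c (Finsupp.single Φ 1)) - w ∈ L →
      w - Finsupp.mapDomain (rt c Q) w ∈ L →
      thetaG c hc2 T₀ (typeSum G c (Finsupp.single Φ 1)) - thetaG c hc2 T₁ (typeSum G c (Finsupp.single Φ 1)) ∈ L := by
    intro w h0 hw
    have h1 := hLrt Q _ h0
    rw [Finsupp.mapDomain_sub, Finsupp.mapDomain_sub, Finsupp.mapDomain_single, mapDomain_rt_thetaG hc2 Q T₀ Φ, hQ, hΦQ] at h1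
    have h := Submodule.sub_mem _ (Submodule.sub_mem _ h1 h0) hw
    have e : thetaG c hc2 T₀ (typeSum G c (Finsupp.single Φ 1)) - thetaG c hc2 T₁ (typeSum G c (Finsupp.single Φ 1)) =
        Finsupp.single Φ 1 - thetaG c hc2 T₁ (typeSum G c (Finsupp.single Φ 1)) - Finsupp.mapDomain (rt c Q) w -
          (Finsupp.single Φ 1 - thetaG c hc2 T₀ (typeSum G c (Finsupp.single Φ 1)) - w) - (w - Finsupp.mapDomain (rt c Q) w) := by abel
    rw [e]; exact h
  -- the four direction cases supply such a `w ∈ {0, −Y_{t'}, −Y_t, −Y_{t'} − Y_t}`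
  have hYt := Y_sub_mapDomain_rt_Y_mem c hc2 hcen T₀ T₁ hbase m hn hH Q hQ hQQ hσH L hLrt hcover hm2 T hTH hTm hT htT
  have hYt' := Y_sub_mapDomain_rt_Y_mem c hc2 hcen T₀ T₁ hbase m hn hH Q hQ hQQ hσH L hLrt hcover hm2 T hTH hTm hT ht'T
  have hdiff : thetaG c hc2 T₀ (typeSum G c (Finsupp.single Φ 1)) - thetaG c hc2 T₁ (typeSum G c (Finsupp.single Φ 1)) ∈ L := by
    rcases hd₁ with h₁ | h₁ <;> rcases hd₂ with h₂ | h₂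
    · refine key 0 ?_ (by rw [Finsupp.mapDomain_zero, sub_zero]; exact Submodule.zero_mem _)
      rw [sub_zero, hρ]
      exact Submodule.add_mem _ (Submodule.add_mem _ (Submodule.sub_mem _ hF hd₁₂) h₁) h₂
    · refine key (-((Finsupp.single (oflipCM c hc2 t T₀) (1 : ℤ) - Finsupp.single T₀ 1) +
        (Finsupp.single (oflipCM c hc2 t T₁) (1 : ℤ) - Finsupp.single T₁ 1))) ?_ ?_
      · rw [sub_neg_eq_add, hρ, add_assoc]
        exact Submodule.add_mem _ (Submodule.add_mem _ (Submodule.sub_mem _ hF hd₁₂) h₁) h₂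
      · rw [hneg, neg_sub_neg, ← neg_sub]; exact Submodule.neg_mem _ hYt
    · refine key (-((Finsupp.single (oflipCM c hc2 t' T₀) (1 : ℤ) - Finsupp.single T₀ 1) +
        (Finsupp.single (oflipCM c hc2 t' T₁) (1 : ℤ) - Finsupp.single T₁ 1))) ?_ ?_
      · rw [sub_neg_eq_add, hρ]
        have e : gface c hc2 Φ t t' -
            (Finsupp.single (oflipCM c hc2 t (oflipCM c hc2 t' Φ)) 1 -
              thetaG c hc2 T₀ (typeSum G c (Finsupp.single (oflipCM c hc2 t (oflipCM c hc2 t' Φ)) 1))) +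
            (Finsupp.single (oflipCM c hc2 t Φ) 1 - thetaG c hc2 T₀ (typeSum G c (Finsupp.single (oflipCM c hc2 t Φ) 1))) +
            (Finsupp.single (oflipCM c hc2 t' Φ) 1 - thetaG c hc2 T₀ (typeSum G c (Finsupp.single (oflipCM c hc2 t' Φ) 1))) +
            ((Finsupp.single (oflipCM c hc2 t' T₀) (1 : ℤ) - Finsupp.single T₀ 1) +
              (Finsupp.single (oflipCM c hc2 t' T₁) (1 : ℤ) - Finsupp.single T₁ 1)) =
            gface c hc2 Φ t t' -
            (Finsupp.single (oflipCM c hc2 t (oflipCM c hc2 t' Φ)) 1 -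
              thetaG c hc2 T₀ (typeSum G c (Finsupp.single (oflipCM c hc2 t (oflipCM c hc2 t' Φ)) 1))) +
            (Finsupp.single (oflipCM c hc2 t Φ) 1 - thetaG c hc2 T₀ (typeSum G c (Finsupp.single (oflipCM c hc2 t Φ) 1)) +
              ((Finsupp.single (oflipCM c hc2 t' T₀) (1 : ℤ) - Finsupp.single T₀ 1) +
                (Finsupp.single (oflipCM c hc2 t' T₁) (1 : ℤ) - Finsupp.single T₁ 1))) +
            (Finsupp.single (oflipCM c hc2 t' Φ) 1 - thetaG c hc2 T₀ (typeSum G c (Finsupp.single (oflipCM c hc2 t' Φ) 1))) := by abel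
        rw [e]
        exact Submodule.add_mem _ (Submodule.add_mem _ (Submodule.sub_mem _ hF hd₁₂) h₁) h₂
      · rw [hneg, neg_sub_neg, ← neg_sub]; exact Submodule.neg_mem _ hYt'
    · refine key (-((Finsupp.single (oflipCM c hc2 t' T₀) (1 : ℤ) - Finsupp.single T₀ 1) +
          (Finsupp.single (oflipCM c hc2 t' T₁) (1 : ℤ) - Finsupp.single T₁ 1)) -
        ((Finsupp.single (oflipCM c hc2 t T₀) (1 : ℤ) - Finsupp.single T₀ 1) +
          (Finsupp.single (oflipCM c hc2 t T₁) (1 : ℤ) - Finsupp.single T₁ 1))) ?_ ?_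
      · rw [hρ]
        have e : gface c hc2 Φ t t' -
            (Finsupp.single (oflipCM c hc2 t (oflipCM c hc2 t' Φ)) 1 -
              thetaG c hc2 T₀ (typeSum G c (Finsupp.single (oflipCM c hc2 t (oflipCM c hc2 t' Φ)) 1))) +
            (Finsupp.single (oflipCM c hc2 t Φ) 1 - thetaG c hc2 T₀ (typeSum G c (Finsupp.single (oflipCM c hc2 t Φ) 1))) +
            (Finsupp.single (oflipCM c hc2 t' Φ) 1 - thetaG c hc2 T₀ (typeSum G c (Finsupp.single (oflipCM c hc2 t' Φ) 1))) -
            (-((Finsupp.single (oflipCM c hc2 t' T₀) (1 : ℤ) - Finsupp.single T₀ 1) +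
                (Finsupp.single (oflipCM c hc2 t' T₁) (1 : ℤ) - Finsupp.single T₁ 1)) -
              ((Finsupp.single (oflipCM c hc2 t T₀) (1 : ℤ) - Finsupp.single T₀ 1) +
                (Finsupp.single (oflipCM c hc2 t T₁) (1 : ℤ) - Finsupp.single T₁ 1))) =
            gface c hc2 Φ t t' -
            (Finsupp.single (oflipCM c hc2 t (oflipCM c hc2 t' Φ)) 1 -
              thetaG c hc2 T₀ (typeSum G c (Finsupp.single (oflipCM c hc2 t (oflipCM c hc2 t' Φ)) 1))) +
            (Finsupp.single (oflipCM c hc2 t Φ) 1 - thetaG c hc2 T₀ (typeSum G c (Finsupp.single (oflipCM c hc2 t Φ) 1)) +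
              ((Finsupp.single (oflipCM c hc2 t' T₀) (1 : ℤ) - Finsupp.single T₀ 1) +
                (Finsupp.single (oflipCM c hc2 t' T₁) (1 : ℤ) - Finsupp.single T₁ 1))) +
            (Finsupp.single (oflipCM c hc2 t' Φ) 1 - thetaG c hc2 T₀ (typeSum G c (Finsupp.single (oflipCM c hc2 t' Φ) 1)) +
              ((Finsupp.single (oflipCM c hc2 t T₀) (1 : ℤ) - Finsupp.single T₀ 1) +
                (Finsupp.single (oflipCM c hc2 t T₁) (1 : ℤ) - Finsupp.single T₁ 1))) := by abel
        rw [e]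
        exact Submodule.add_mem _ (Submodule.add_mem _ (Submodule.sub_mem _ hF hd₁₂) h₁) h₂
      · rw [Finsupp.mapDomain_sub, hneg]
        have e : -((Finsupp.single (oflipCM c hc2 t' T₀) (1 : ℤ) - Finsupp.single T₀ 1) +
              (Finsupp.single (oflipCM c hc2 t' T₁) (1 : ℤ) - Finsupp.single T₁ 1)) -
            ((Finsupp.single (oflipCM c hc2 t T₀) (1 : ℤ) - Finsupp.single T₀ 1) +
              (Finsupp.single (oflipCM c hc2 t T₁) (1 : ℤ) - Finsupp.single T₁ 1)) -
            (-Finsupp.mapDomain (rt c Q) ((Finsupp.single (oflipCM c hc2 t' T₀) (1 : ℤ) - Finsupp.single T₀ 1) +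
                (Finsupp.single (oflipCM c hc2 t' T₁) (1 : ℤ) - Finsupp.single T₁ 1)) -
              Finsupp.mapDomain (rt c Q) ((Finsupp.single (oflipCM c hc2 t T₀) (1 : ℤ) - Finsupp.single T₀ 1) +
                (Finsupp.single (oflipCM c hc2 t T₁) (1 : ℤ) - Finsupp.single T₁ 1))) =
            -(((Finsupp.single (oflipCM c hc2 t' T₀) (1 : ℤ) - Finsupp.single T₀ 1) +
                (Finsupp.single (oflipCM c hc2 t' T₁) (1 : ℤ) - Finsupp.single T₁ 1)) -
              Finsupp.mapDomain (rt c Q) ((Finsupp.single (oflipCM c hc2 t' T₀) (1 : ℤ) - Finsupp.single T₀ 1) +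
                (Finsupp.single (oflipCM c hc2 t' T₁) (1 : ℤ) - Finsupp.single T₁ 1))) -
            (((Finsupp.single (oflipCM c hc2 t T₀) (1 : ℤ) - Finsupp.single T₀ 1) +
                (Finsupp.single (oflipCM c hc2 t T₁) (1 : ℤ) - Finsupp.single T₁ 1)) -
              Finsupp.mapDomain (rt c Q) ((Finsupp.single (oflipCM c hc2 t T₀) (1 : ℤ) - Finsupp.single T₀ 1) +
                (Finsupp.single (oflipCM c hc2 t T₁) (1 : ℤ) - Finsupp.single T₁ 1))) := by abel
        rw [e]; exact Submodule.sub_mem _ (Submodule.neg_mem _ hYt') hYt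
  -- expand `θ_{T₀}(Φ) − θ_{T₁}(Φ) = R(T) + Y'_a + Y'_{a'}` (part VIʼs computation) and remove `R(T) ∈ L`
  have hD1 : (T₀.1 \ Φ.1) \ (T₀.1 \ T₁.1) = {a, a'} := by
    rw [hΦ, union_sdiff_distrib, Finset.sdiff_eq_empty_iff_subset.mpr hTH, empty_union]
    ext x; simp only [mem_sdiff, mem_insert, mem_singleton]
    constructor
    · exact fun h => h.1
    · rintro (rfl | rfl)
      · exact ⟨Or.inl rfl, fun h => haH (mem_sdiff.mpr h)⟩
      · exact ⟨Or.inr rfl, fun h => ha'H (mem_sdiff.mpr h)⟩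
  have hD2 : (T₀.1 \ T₁.1) \ (T₀.1 \ Φ.1) = (T₀.1 \ T₁.1) \ T := by
    rw [hΦ]
    ext x; simp only [mem_sdiff, mem_union, mem_insert, mem_singleton, not_or]
    constructor
    · rintro ⟨h, h1, -⟩; exact ⟨h, h1⟩
    · rintro ⟨h, h1⟩
      refine ⟨h, h1, ?_, ?_⟩
      · rintro rfl; exact haH (mem_sdiff.mpr h)
      · rintro rfl; exact ha'H (mem_sdiff.mpr h)
  rw [thetaG_typeSum_single c T₀ hc2 Φ, thetaG_frame c hc2 T₀ T₁ Φ, hD1, hD2, hΦ, sum_union hTA, sum_pair hne, sum_pair hne] at hdiff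
  have hR := rel_transversal_mem c hc2 hcen T₀ T₁ hbase m hn hH Q hQ hQQ hσH L hLrt hcover hm2 T hTH hTm hT
  have hcardD : (((T₀.1 \ T₁.1) \ T).card : ℤ) = m := by
    have h : ((T₀.1 \ T₁.1) \ T).card = m := by rw [card_sdiff_of_subset hTH, hH, hTm]; omega
    exact_mod_cast h
  have hTm' : (T.card : ℤ) = m := by exact_mod_cast hTm
  have h := Submodule.sub_mem _ hdiff hR
  rw [sum_sub_distrib, sum_sub_distrib, sum_const, sum_const, ← Nat.cast_smul_eq_nsmul ℤ, ← Nat.cast_smul_eq_nsmul ℤ, hcardD, hTm'] at h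
  have e : ((Finsupp.single (oflipCM c hc2 a T₀) (1 : ℤ) - Finsupp.single T₀ 1) - (Finsupp.single (oflipCM c hc2 a T₁) (1 : ℤ) - Finsupp.single T₁ 1)) +
      ((Finsupp.single (oflipCM c hc2 a' T₀) (1 : ℤ) - Finsupp.single T₀ 1) - (Finsupp.single (oflipCM c hc2 a' T₁) (1 : ℤ) - Finsupp.single T₁ 1)) =
      ((∑ x ∈ T, Finsupp.single (oflipCM c hc2 x T₀) (1 : ℤ) - (m : ℤ) • Finsupp.single T₀ (1 : ℤ)) +
        ((Finsupp.single (oflipCM c hc2 a T₀) (1 : ℤ) - Finsupp.single T₀ 1) + (Finsupp.single (oflipCM c hc2 a' T₀) (1 : ℤ) - Finsupp.single T₀ 1)) +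
        Finsupp.single T₀ 1 -
      (((Finsupp.single (oflipCM c hc2 a T₁) (1 : ℤ) - Finsupp.single T₁ 1) + (Finsupp.single (oflipCM c hc2 a' T₁) (1 : ℤ) - Finsupp.single T₁ 1)) +
        (∑ x ∈ (T₀.1 \ T₁.1) \ T, Finsupp.single (oflipCM c hc2 x T₁) (1 : ℤ) - (m : ℤ) • Finsupp.single T₁ (1 : ℤ)) + Finsupp.single T₁ 1)) -
      (∑ s ∈ T, Finsupp.single (oflipCM c hc2 s T₀) (1 : ℤ) - ∑ u ∈ (T₀.1 \ T₁.1) \ T, Finsupp.single (oflipCM c hc2 u T₁) (1 : ℤ) -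
        ((m : ℤ) - 1) • (Finsupp.single T₀ (1 : ℤ) - Finsupp.single T₁ 1)) := by module
  rw [e]; exact h

/-! ## §2 The companion designated face gives `Y_s + Y_{σs}` -/

include hcen hbase hn hH hQ hQQ hσH hLrt hP hcover in
/-- **THE COMPANION DESIGNATED PAIR FACE RELATION** (`m = 2`) — §4 in the companion frame `(T₀; T̄₁, c·Q)`, modulo pairs.  Let `T' = {u, u'} ⊆ T₀ ∩ T₁`
be a transversal of the place involution, `s ∈ 𝓗` with swap image `s'`, and `Φ` the type with `D(Φ) = T' ∪ {s, s'}`.  If the face of `Φ` with places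
`u, u'` lies in `L` and `R({s, s'}) ∈ L`, then **`Y_s + Y_{s'} = ((f_s − e₀) + (g_s − e₁)) + ((f_{s'} − e₀) + (g_{s'} − e₁)) ∈ L`**. [folklore] -/
theorem Y_add_Y_mem_of_pair_face (hm : m = 2) (T' : Finset G) (hTH' : T' ⊆ T₀.1 ∩ T₁.1) (hTm' : T'.card = m)
    (hT' : ∀ t ∈ T₀.1 ∩ T₁.1, ∀ t' ∈ T₀.1, (t' = t * Q ∨ t' = c * (t * Q)) → (t ∈ T' ↔ t' ∉ T'))
    {u u' : G} (hTe : T' = {u, u'}) (huu' : u ≠ u')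
    {s s' : G} (hs : s ∈ T₀.1 \ T₁.1) (hs' : s' ∈ T₀.1) (hss' : s' = s * Q ∨ s' = c * (s * Q))
    (Φ : CMF G c) (hΦ : T₀.1 \ Φ.1 = T' ∪ {s, s'}) (hF : gface c hc2 Φ u u' ∈ L)
    (hR : ∑ x ∈ ({s, s'} : Finset G), Finsupp.single (oflipCM c hc2 x T₀) (1 : ℤ) -
        ∑ v ∈ (T₀.1 \ T₁.1) \ {s, s'}, Finsupp.single (oflipCM c hc2 v T₁) (1 : ℤ) -
        ((m : ℤ) - 1) • (Finsupp.single T₀ (1 : ℤ) - Finsupp.single T₁ 1) ∈ L) :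
    ((Finsupp.single (oflipCM c hc2 s T₀) (1 : ℤ) - Finsupp.single T₀ 1) + (Finsupp.single (oflipCM c hc2 s T₁) (1 : ℤ) - Finsupp.single T₁ 1)) +
      ((Finsupp.single (oflipCM c hc2 s' T₀) (1 : ℤ) - Finsupp.single T₀ 1) + (Finsupp.single (oflipCM c hc2 s' T₁) (1 : ℤ) - Finsupp.single T₁ 1))
      ∈ L := by
  have hHc : T₀.1 \ (rt c c T₁).1 = T₀.1 ∩ T₁.1 := sdiff_compl_eq_inter c hcen T₀ T₁
  have hHc' : T₀.1 ∩ (rt c c T₁).1 = T₀.1 \ T₁.1 := by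
    ext x; rw [mem_inter, mem_compl_type_iff c hcen T₁, mem_sdiff]
  have hT2 : ∀ t ∈ T₀.1 \ (rt c c T₁).1, ∀ t' ∈ T₀.1, (t' = t * (c * Q) ∨ t' = c * (t * (c * Q))) → (t ∈ T' ↔ t' ∉ T') := by
    intro t ht t' ht' h
    rw [or_companion_iff c hc2 hcen Q] at h
    rw [hHc] at ht
    exact hT' t ht t' ht' h
  have hs1 : s ∈ T₀.1 ∩ (rt c c T₁).1 := by rw [hHc']; exact hs
  have hsr : ∀ X : CMF G c, Finsupp.single (rt c c X) (1 : ℤ) = pair c X - Finsupp.single X 1 := fun X => by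
    rw [pair, add_sub_cancel_left]
  -- `Rᶜ` of the companion frame at `{s, s'}` is `R({s, s'})` plus pairs
  have hRc' : ∑ x ∈ ({s, s'} : Finset G), Finsupp.single (oflipCM c hc2 x T₀) (1 : ℤ) +
      ∑ v ∈ (T₀.1 ∩ (rt c c T₁).1) \ {s, s'}, Finsupp.single (oflipCM c hc2 v (rt c c T₁)) (1 : ℤ) -
      ((m : ℤ) - 1) • (Finsupp.single T₀ (1 : ℤ) + Finsupp.single (rt c c T₁) 1) ∈ L := by
    rw [hHc']
    simp only [oflipCM_rt_self c hc2 hcen, hsr]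
    have hp : ∑ v ∈ (T₀.1 \ T₁.1) \ {s, s'}, pair c (oflipCM c hc2 v T₁) - ((m : ℤ) - 1) • pair c T₁ ∈ L :=
      Submodule.sub_mem _ (Submodule.sum_mem _ fun v _ => hP _) (Submodule.smul_mem _ _ (hP _))
    have e : ∑ x ∈ ({s, s'} : Finset G), Finsupp.single (oflipCM c hc2 x T₀) (1 : ℤ) +
        ∑ v ∈ (T₀.1 \ T₁.1) \ {s, s'}, (pair c (oflipCM c hc2 v T₁) - Finsupp.single (oflipCM c hc2 v T₁) (1 : ℤ)) -
        ((m : ℤ) - 1) • (Finsupp.single T₀ (1 : ℤ) + (pair c T₁ - Finsupp.single T₁ 1)) =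
        (∑ x ∈ ({s, s'} : Finset G), Finsupp.single (oflipCM c hc2 x T₀) (1 : ℤ) -
          ∑ v ∈ (T₀.1 \ T₁.1) \ {s, s'}, Finsupp.single (oflipCM c hc2 v T₁) (1 : ℤ) -
          ((m : ℤ) - 1) • (Finsupp.single T₀ (1 : ℤ) - Finsupp.single T₁ 1)) +
        (∑ v ∈ (T₀.1 \ T₁.1) \ {s, s'}, pair c (oflipCM c hc2 v T₁) - ((m : ℤ) - 1) • pair c T₁) := by
      rw [sum_sub_distrib]; module
    rw [e]; exact Submodule.add_mem _ hR hp
  have h := Y'_add_Y'_mem_of_pair_face c hc2 hcen T₀ (rt c c T₁) (companion_base c hc2 T₀ T₁ hbase) m hn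
    (companion_card c hcen T₀ T₁ m hn hH) (c * Q) (companion_rt c T₀ T₁ Q hQ) (companion_sq c hc2 hcen Q hQQ)
    (companion_swap c hc2 hcen T₀ T₁ Q hσH) L hLrt hP hcover hm T' (by rw [hHc]; exact hTH') hTm' hT2 hTe huu' hs1 hs'
    ((or_companion_iff c hc2 hcen Q s s').mpr hss') Φ hΦ hF hRc'
  simp only [oflipCM_rt_self c hc2 hcen, hsr] at h
  have hp : pair c (oflipCM c hc2 s T₁) + pair c (oflipCM c hc2 s' T₁) - (2 : ℤ) • pair c T₁ ∈ L :=
    Submodule.sub_mem _ (Submodule.add_mem _ (hP _) (hP _)) (Submodule.smul_mem _ _ (hP _))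
  have e : ((Finsupp.single (oflipCM c hc2 s T₀) (1 : ℤ) - Finsupp.single T₀ 1) + (Finsupp.single (oflipCM c hc2 s T₁) (1 : ℤ) - Finsupp.single T₁ 1)) +
      ((Finsupp.single (oflipCM c hc2 s' T₀) (1 : ℤ) - Finsupp.single T₀ 1) + (Finsupp.single (oflipCM c hc2 s' T₁) (1 : ℤ) - Finsupp.single T₁ 1)) =
      (((Finsupp.single (oflipCM c hc2 s T₀) (1 : ℤ) - Finsupp.single T₀ 1) -
          ((pair c (oflipCM c hc2 s T₁) - Finsupp.single (oflipCM c hc2 s T₁) 1) - (pair c T₁ - Finsupp.single T₁ 1))) +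
        ((Finsupp.single (oflipCM c hc2 s' T₀) (1 : ℤ) - Finsupp.single T₀ 1) -
          ((pair c (oflipCM c hc2 s' T₁) - Finsupp.single (oflipCM c hc2 s' T₁) 1) - (pair c T₁ - Finsupp.single T₁ 1)))) +
      (pair c (oflipCM c hc2 s T₁) + pair c (oflipCM c hc2 s' T₁) - (2 : ℤ) • pair c T₁) := by module
  rw [e]
  exact Submodule.add_mem _ h hp

end Frame

end

end Summit.HodgeConjecture.CorCM.Census.CentralSquares
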